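import Mathlib
import Literature.MathematicalPhysics.QuantumLattice.GrassmannGaussianQuadraticInsertionConv
import Literature.MathematicalPhysics.QuantumLattice.HubbardCounterQuadraticResummation
import Literature.MathematicalPhysics.QuantumLattice.GrassmannChargeScaling
import HarnessLib

/-!
# A DIAGONAL two-leg vertex resummed into a normal covariance — all degrees:
# `effAction (normalCovariance p) (V + 𝒩_κ) = effAction (normalCovariance p) 𝒩_κ + S_m (effAction (normalCovariance p̃) V)`, `p̃ = p/(1 + pκ)`

Topic `Literature/MathematicalPhysics/QuantumLattice`; the model-level instance of `GrassmannGaussianQuadraticInsertionConv.effAction_sub_quadratic`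
(convolution level, every degree) in the normal-form algebra of `HubbardQuadraticShift` / `HubbardCounterQuadraticResummation` (whose
`selfEnergy_effAction_add_counterQuadratic` is the two-leg shadow of the present statement for the counterterm symbol).  For a normal charged
covariance `C = normalCovariance p` (momentum/frequency/spin diagonal, pairing `ψ⁺_{kσ}` with `ψ⁻_{kσ}` — every cutoff covariance of the Hubbard
effective-action files at seed `0`) and a DIAGONAL quadratic vertex `𝒩_κ = Σ_{kσ} κ(k,σ)·ψ̂⁺_{kσ}ψ̂⁻_{kσ}` with an ARBITRARY symbol
`κ : FreqMomentum × Fin 2 → ℂ` (frequency- AND momentum-dependent: the full two-leg kernel of a charge/momentum/frequency/spin-conserving action,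
not only a static counterterm), and every `V` without constant part:

* `sum_sum_diagPairMatrix_smul` — the pair-supported coefficient matrix sums to `Σ_{kσ} c(k,σ)·ψ⁺_{kσ}ψ⁻_{kσ}`;
* `toLin'_diagonal_eq_mulLeft` — the substitution by a diagonal matrix is the charge scaling `S_m : ψ(X) ↦ m(X)ψ(X)` of `GrassmannChargeScaling`;
* **`effAction_normalCovariance_add_diagQuadratic`** (all `1 + p(k,σ)κ(k,σ) ≠ 0`, unit partition functions):
  `effAction C (V + 𝒩_κ) = effAction C 𝒩_κ + S_m (effAction C̃ V)`,  `C̃ = normalCovariance (p/(1 + pκ))`,  `m(X) = (1 + p(X₁)κ(X₁))⁻¹`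
  — the two-leg vertex disappears from the expansion of the second summand: its lines are the DRESSED normal covariance `p̃ = p/(1 + pκ)`
  (`= 1/(p⁻¹ + κ)` where `p ≠ 0`: «`E = e + K` in the propagator», Feldman–Salmhofer–Trubowitz 1996 §1; `E_{h−1} = E_h + C_h^{−1}n̂_h`,
  Benfatto–Giuliani–Mastropietro 2006 (2.23)), its external legs carry `m = 1 − κp̃` (`= 1` wherever the symbol `p` vanishes), and the first
  summand is the `V`-independent Gaussian effective action of `𝒩_κ` alone (explicitly quadratic: the chain `βL²κ − βL²κ²p̃` of
  `selfEnergy_effAction_add_counterQuadratic`).  Kernels of the substituted term: `kernel (S_m F) n X = (∏ᵢ m(Xᵢ))·kernel F n X`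
  (`GrassmannChargeScaling.kernel_map_mulLeft`).

Everything is proved; no definitions (the quadratic vertex is passed as the hypothesis `hQ`); no named facts.

## Sources

G. Benfatto, A. Giuliani, V. Mastropietro, Ann. Henri Poincaré 7 (2006) 809–898, §2.3 (2.21)–(2.24) [`BenfattoGiulianiMastropietro2006`];
J. Feldman, M. Salmhofer, E. Trubowitz, J. Stat. Phys. 84 (1996) 1209–1336, §1 [`FeldmanSalmhoferTrubowitz1996`].
-/

noncomputable section

namespace Literature.MathematicalPhysics.QuantumLattice

open GrassmannAlgebra Finset Literature.Probability.LatticeModels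

variable {L M : ℕ} [NeZero L]

/-- **The pair-supported coefficient matrix sums to the diagonal quadratic vertex**:
`Σ_{X,Y} N_c(X,Y) ψ(X)ψ(Y) = Σ_{kσ} c(k,σ) ψ⁺_{kσ}ψ⁻_{kσ}` for `N_c((kσ,+),(kσ,−)) = c(k,σ)` and `0` otherwise (the shape of
`HubbardCovarianceFrameResolvent.neg_counterQuadratic_eq_sum`). [cite: BenfattoGiulianiMastropietro2006, §2.3 (2.22)] -/
theorem sum_sum_diagPairMatrix_smul (c : FreqMomentum L M × Fin 2 → ℂ) :
    ∑ X : HubbardFieldIdx L M, ∑ Y : HubbardFieldIdx L M,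
        (Matrix.of fun Z W : HubbardFieldIdx L M => if Z.2 = 0 ∧ W = (Z.1, 1) then c Z.1 else 0) X Y • (gen ℂ X * gen ℂ Y) =
      ∑ ks : FreqMomentum L M × Fin 2, c ks • (gen ℂ ((ks, 0) : HubbardFieldIdx L M) * gen ℂ ((ks, 1) : HubbardFieldIdx L M)) := by
  have inner : ∀ X : HubbardFieldIdx L M,
      ∑ Y : HubbardFieldIdx L M, (Matrix.of fun Z W : HubbardFieldIdx L M => if Z.2 = 0 ∧ W = (Z.1, 1) then c Z.1 else 0) X Y •
          (gen ℂ X * gen ℂ Y) =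
        if X.2 = 0 then c X.1 • (gen ℂ X * gen ℂ (X.1, 1)) else 0 := by
    rintro ⟨X₁, d⟩
    fin_cases d
    · simp only [Matrix.of_apply, Fin.zero_eta, Fin.isValue, true_and, ite_smul, zero_smul, Finset.sum_ite_eq',
        Finset.mem_univ, if_true]
    · simp
  simp only [inner]
  simp only [Fintype.sum_prod_type, Fin.sum_univ_two, Fin.isValue, if_true, one_ne_zero, if_false, add_zero]

omit [NeZero L] in
/-- **The substitution by a diagonal matrix is a charge scaling**: `Matrix.toLin' (diagonal m) = LinearMap.mulLeft ℂ m`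
(`GrassmannLinearSubstitution.toMatrix'_mulLeft`). [cite: BenfattoGiulianiMastropietro2006, §2.3 (2.24)] -/
theorem toLin'_diagonal_eq_mulLeft {Γ : Type*} [Fintype Γ] [DecidableEq Γ] (m : Γ → ℂ) :
    Matrix.toLin' (Matrix.diagonal m) = LinearMap.mulLeft ℂ m := by
  rw [← toMatrix'_mulLeft, Matrix.toLin'_toMatrix']

section Main

variable (p κ : FreqMomentum L M × Fin 2 → ℂ) (hden : ∀ ks, 1 + p ks * κ ks ≠ 0)
  {Q V : HubbardGrassmann L M}
  (hQ : Q = ∑ ks : FreqMomentum L M × Fin 2, κ ks • (gen ℂ ((ks, 0) : HubbardFieldIdx L M) * gen ℂ ((ks, 1) : HubbardFieldIdx L M)))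
  (hV0 : constPart ℂ V = 0)
  (hZQ : IsUnit (effPartitionFn ℂ (normalCovariance L M p) Q))
  (hZV : IsUnit (effPartitionFn ℂ (normalCovariance L M fun ks => p ks / (1 + p ks * κ ks)) V))

include hden hQ hV0 hZQ hZV

/-- **A diagonal two-leg vertex resummed into a normal covariance, at the level of the Wilsonian effective action (all degrees).**
`C = normalCovariance p`, `𝒩_κ = Σ_{kσ} κ(k,σ)ψ⁺_{kσ}ψ⁻_{kσ}`, all `1 + pκ ≠ 0`, `V` without constant part, unit partition functions
`Z_C(𝒩_κ)` and `Z_{C̃}(V)`; then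
`effAction C (V + 𝒩_κ) = effAction C 𝒩_κ + S_m (effAction C̃ V)`, `C̃ = normalCovariance (p/(1 + pκ))`, `S_m = ExteriorAlgebra.map (mulLeft m)`,
`m(X) = (1 + p(X₁)κ(X₁))⁻¹` — `GrassmannGaussianQuadraticInsertionConv.effAction_sub_quadratic` with `q = −𝒩_κ`, `S = normalCovariance (−κ)`,
`M = diagonal m` (`HubbardCounterQuadraticResummation.counterS_eq_normalCovariance`, `diagonal_mul_one_add_normalCovariance_mul_normalCovariance_neg`)
and `M·C = normalCovariance (m·p)` (`HubbardQuadraticShift.diagonal_mul_normalCovariance`).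
[cite: BenfattoGiulianiMastropietro2006, §2.3 (2.21)–(2.24)] -/
theorem effAction_normalCovariance_add_diagQuadratic :
    effAction ℂ (normalCovariance L M p) (V + Q) =
      effAction ℂ (normalCovariance L M p) Q +
        ExteriorAlgebra.map (LinearMap.mulLeft ℂ fun X : HubbardFieldIdx L M => (1 + p X.1 * κ X.1)⁻¹)
          (effAction ℂ (normalCovariance L M fun ks => p ks / (1 + p ks * κ ks)) V) := by
  -- the insertion `q = −𝒩_κ` as a pair-supported double sum
  set c : FreqMomentum L M × Fin 2 → ℂ := fun ks => -κ ks with hc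
  set N : Matrix (HubbardFieldIdx L M) (HubbardFieldIdx L M) ℂ :=
    Matrix.of fun Z W : HubbardFieldIdx L M => if Z.2 = 0 ∧ W = (Z.1, 1) then c Z.1 else 0 with hN
  have hq : -Q = ∑ X : HubbardFieldIdx L M, ∑ Y : HubbardFieldIdx L M, N X Y • (gen ℂ X * gen ℂ Y) := by
    rw [hN, sum_sum_diagPairMatrix_smul c, hQ, ← Finset.sum_neg_distrib]
    refine Finset.sum_congr rfl fun ks _ => ?_
    rw [hc, neg_smul]
  -- the normal-form data
  set C := normalCovariance L M p with hCdef
  have hC : C.transpose = -C := normalCovariance_transpose p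
  set S : Matrix (HubbardFieldIdx L M) (HubbardFieldIdx L M) ℂ := Matrix.of fun X Y => N X Y - N Y X with hSdef
  have hS : S = Matrix.of fun X Y => N X Y - N Y X := rfl
  have hSnc : S = normalCovariance L M fun ks => -κ ks := by
    rw [hSdef, hN, hc]; exact counterS_eq_normalCovariance κ
  set m : FreqMomentum L M × Fin 2 → ℂ := fun ks => (1 + p ks * κ ks)⁻¹ with hm
  set Mx : Matrix (HubbardFieldIdx L M) (HubbardFieldIdx L M) ℂ := Matrix.diagonal fun X => m X.1 with hMx
  have hM : Mx * (1 + C * S) = 1 := by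
    rw [hMx, hCdef, hSnc]
    exact diagonal_mul_one_add_normalCovariance_mul_normalCovariance_neg p κ hden
  -- the renormalised covariance is the normal covariance of `p/(1 + pκ)`
  set p' : FreqMomentum L M × Fin 2 → ℂ := fun ks => p ks / (1 + p ks * κ ks) with hp'
  have hMC : Mx * C = normalCovariance L M p' := by
    rw [hMx, hCdef, diagonal_mul_normalCovariance]
    congr 1
    funext ks
    rw [hp', hm]
    simp only
    rw [div_eq_mul_inv, mul_comm]
  -- the substitution by `Mx` is the charge scaling by `m`
  have hsub : Matrix.toLin' Mx.transpose = LinearMap.mulLeft ℂ fun X : HubbardFieldIdx L M => (1 + p X.1 * κ X.1)⁻¹ := by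
    rw [hMx, Matrix.diagonal_transpose, toLin'_diagonal_eq_mulLeft]
  -- the generic convolution-level insertion theorem
  have hZq : IsUnit (effPartitionFn ℂ C (-(-Q))) := by rw [neg_neg]; exact hZQ
  have hZV' : IsUnit (effPartitionFn ℂ (Mx * C) V) := by rw [hMC]; exact hZV
  have key := effAction_sub_quadratic N hq hC hS hM V hV0 hZq hZV'
  rw [sub_neg_eq_add, neg_neg, hMC, hsub] at key
  exact key

/-! ### Appended (p1 g10, same session): the partition functions factorise — only the UNDRESSED one needs to be a unit -/

omit hZQ hZV in
/-- **The partition function factorises**: `Z_C(V + 𝒩_κ) = Z_C(𝒩_κ) · Z_{C̃}(V)` (`effPartitionFn_sub_quadratic` at the normal-form data; no unit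
hypothesis).  Hence `Z_C(V + 𝒩_κ) ≠ 0` alone gives BOTH unit hypotheses of `effAction_normalCovariance_add_diagQuadratic`
(`isUnit_effPartitionFn_diagQuadratic_of_ne_zero`, `isUnit_effPartitionFn_dressed_of_ne_zero`). [cite: BenfattoGiulianiMastropietro2006, §2.3 (2.24)] -/
theorem effPartitionFn_normalCovariance_add_diagQuadratic :
    effPartitionFn ℂ (normalCovariance L M p) (V + Q) =
      effPartitionFn ℂ (normalCovariance L M p) Q * effPartitionFn ℂ (normalCovariance L M fun ks => p ks / (1 + p ks * κ ks)) V := by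
  set c : FreqMomentum L M × Fin 2 → ℂ := fun ks => -κ ks with hc
  set N : Matrix (HubbardFieldIdx L M) (HubbardFieldIdx L M) ℂ :=
    Matrix.of fun Z W : HubbardFieldIdx L M => if Z.2 = 0 ∧ W = (Z.1, 1) then c Z.1 else 0 with hN
  have hq : -Q = ∑ X : HubbardFieldIdx L M, ∑ Y : HubbardFieldIdx L M, N X Y • (gen ℂ X * gen ℂ Y) := by
    rw [hN, sum_sum_diagPairMatrix_smul c, hQ, ← Finset.sum_neg_distrib]
    refine Finset.sum_congr rfl fun ks _ => ?_
    rw [hc, neg_smul]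
  set C := normalCovariance L M p with hCdef
  have hC : C.transpose = -C := normalCovariance_transpose p
  set S : Matrix (HubbardFieldIdx L M) (HubbardFieldIdx L M) ℂ := Matrix.of fun X Y => N X Y - N Y X with hSdef
  have hS : S = Matrix.of fun X Y => N X Y - N Y X := rfl
  have hSnc : S = normalCovariance L M fun ks => -κ ks := by
    rw [hSdef, hN, hc]; exact counterS_eq_normalCovariance κ
  set m : FreqMomentum L M × Fin 2 → ℂ := fun ks => (1 + p ks * κ ks)⁻¹ with hm
  set Mx : Matrix (HubbardFieldIdx L M) (HubbardFieldIdx L M) ℂ := Matrix.diagonal fun X => m X.1 with hMx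
  have hM : Mx * (1 + C * S) = 1 := by
    rw [hMx, hCdef, hSnc]
    exact diagonal_mul_one_add_normalCovariance_mul_normalCovariance_neg p κ hden
  set p' : FreqMomentum L M × Fin 2 → ℂ := fun ks => p ks / (1 + p ks * κ ks) with hp'
  have hMC : Mx * C = normalCovariance L M p' := by
    rw [hMx, hCdef, diagonal_mul_normalCovariance]
    congr 1
    funext ks
    rw [hp', hm]
    simp only
    rw [div_eq_mul_inv, mul_comm]
  have key := effPartitionFn_sub_quadratic N hq hC hS hM V hV0
  rw [sub_neg_eq_add, neg_neg, hMC] at key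
  exact key

omit hZQ hZV in
/-- If the undressed partition function `Z_C(V + 𝒩_κ)` is nonzero then `Z_C(𝒩_κ)` is a unit. [cite: BenfattoGiulianiMastropietro2006, §2.3 (2.24)] -/
theorem isUnit_effPartitionFn_diagQuadratic_of_ne_zero (hZ : effPartitionFn ℂ (normalCovariance L M p) (V + Q) ≠ 0) :
    IsUnit (effPartitionFn ℂ (normalCovariance L M p) Q) := by
  rw [effPartitionFn_normalCovariance_add_diagQuadratic p κ hden hQ hV0] at hZ
  exact isUnit_iff_ne_zero.2 (left_ne_zero_of_mul hZ)

omit hZQ hZV in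
/-- If the undressed partition function `Z_C(V + 𝒩_κ)` is nonzero then the DRESSED one `Z_{C̃}(V)` is a unit. [cite: BenfattoGiulianiMastropietro2006, §2.3 (2.24)] -/
theorem isUnit_effPartitionFn_dressed_of_ne_zero (hZ : effPartitionFn ℂ (normalCovariance L M p) (V + Q) ≠ 0) :
    IsUnit (effPartitionFn ℂ (normalCovariance L M fun ks => p ks / (1 + p ks * κ ks)) V) := by
  rw [effPartitionFn_normalCovariance_add_diagQuadratic p κ hden hQ hV0] at hZ
  exact isUnit_iff_ne_zero.2 (right_ne_zero_of_mul hZ)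

omit hZQ hZV in
/-- **The resummation identity from the UNDRESSED partition function alone**: `Z_C(V + 𝒩_κ) ≠ 0` suffices.
[cite: BenfattoGiulianiMastropietro2006, §2.3 (2.21)–(2.24)] -/
theorem effAction_normalCovariance_add_diagQuadratic_of_ne_zero (hZ : effPartitionFn ℂ (normalCovariance L M p) (V + Q) ≠ 0) :
    effAction ℂ (normalCovariance L M p) (V + Q) =
      effAction ℂ (normalCovariance L M p) Q +
        ExteriorAlgebra.map (LinearMap.mulLeft ℂ fun X : HubbardFieldIdx L M => (1 + p X.1 * κ X.1)⁻¹)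
          (effAction ℂ (normalCovariance L M fun ks => p ks / (1 + p ks * κ ks)) V) :=
  effAction_normalCovariance_add_diagQuadratic p κ hden hQ hV0
    (isUnit_effPartitionFn_diagQuadratic_of_ne_zero p κ hden hQ hV0 hZ) (isUnit_effPartitionFn_dressed_of_ne_zero p κ hden hQ hV0 hZ)

end Main

end Literature.MathematicalPhysics.QuantumLattice

end
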